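import Literature.NumberTheory.GaloisRepresentations.HomDualReadoutNaturality
import Mathlib.Algebra.Module.Projective
import HarnessLib

/-!
# The covariant `Hom(N, ·)`-image of a short exact sequence of discrete Galois modules (for `N` a lattice), its
# connecting maps, and the change-of-group naturality of `δ₁`

Topic `NumberTheory/GaloisRepresentations`; namespaces `Literature.NumberTheory.GaloisRepresentations.IsSES` (§1) and
`…HomDual` (§2–§3).  Definitions with bodies (`postcomp`) and theorems; no named fact, no instance, no `sorry`.  Sequel of
`HomDualPresentation` (the CONTRAVARIANT dual `0 → Hom(Z, A) → Hom(Y, A) → Hom(X, A) → 0` of a presentation against a Baer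
module, `isSES_dual`, `dualδ₀`) and of `HomDualReadoutNaturality` (`IsSES.map_res_δ₀`: `δ₀` commutes with change of group).

§1 (generic, any locally compact groups `Γ, Γ'`).  For a continuous `θ : Γ' → Γ`, a short exact sequence
`0 → M₁ → M₂ → M₃ → 0` of discrete `Γ`-modules, one `0 → M₁' → M₂' → M₃' → 0` of discrete `Γ'`-modules and `θ`-equivariant
`φᵢ : Mᵢ → Mᵢ'` forming commutative squares, the degree-`1 → 2` connecting maps of `ContinuousCohomologyConnecting`
satisfy **`H²(θ, φ₁) ∘ δ₁ = δ₁' ∘ H¹(θ, φ₃)`** (`IsSES.map_res_δ₁`; NSW (1.3.3) with change of group, (1.5.2)); and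
**`H¹(θ, φ₁) ∘ δ₀ = 0` as soon as `φ₁` EXTENDS over `M₂`** along `θ` (`IsSES.map_res_δ₀_eq_zero_of_extends`: if
`φ₂' : M₂ → M₁'` is `θ`-equivariant with `φ₂' ∘ f = φ₁`, the pulled-back `δ₀`-cocycle `σ ↦ φ₁(f⁻¹((θσ) w − w))` is the
coboundary of `φ₂'(w)`).

§2–§3 (any field `K : Type`).  For a discrete Galois module `N` finitely generated and PROJECTIVE over `ℤ` (a lattice) and a
short exact sequence `0 → X —i→ Y —p→ Z → 0` of discrete Galois modules, post-composition `F ↦ u ∘ F` is an equivariant map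
`Hom_ℤ(N, Y) → Hom_ℤ(N, Z)` (`postcomp`), and **`0 → Hom_ℤ(N, X) → Hom_ℤ(N, Y) → Hom_ℤ(N, Z) → 0` is again a short exact
sequence of discrete Galois modules** (`isSES_hom`; surjectivity on the right is the lifting property of the projective
module `N`).  Its native connecting map `δ₀ : Hom_{Γ_K}(N, Z) → H¹(K, Hom_ℤ(N, X))` is `(isSES_hom …).δ₀`.

USE (the degree-`2` step of the presentation road to Milne ADT I Thm. 4.10 (a), cell `bsd-wall` seat `bsd-line-chl-p2`):
with `N = N₁` the relation lattice of door-c4's presentation of a finite module `M` and the idèle class sequence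
`0 → K̄ˣ → J̄ → C̄ → 0`, the composite `δ₁^{Hom(S, K̄ˣ)} ∘ δ₀^{Hom(N₁, T)} : Hom_{Γ_K}(N₁, C̄) → H²(K, Hom(M, K̄ˣ)) = H²(K, M^D)`
is the NATIVE obstruction map whose local vanishing is `map_res_δ₁` + `map_res_δ₀_eq_zero_of_extends` (the idèle
projection `π_v : J̄ → K̄_vˣ` extends `ι_v : K̄ˣ → K̄_vˣ`).
HONEST FRAMING: homological bookkeeping; no case of Poitou–Tate or BSD is proved here.

## References
* J. Neukirch, A. Schmidt, K. Wingberg, *Cohomology of Number Fields* (2008), (1.3.2), (1.3.3), (1.5.2).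
  [NeukirchSchmidtWingberg2008]
* J.-P. Serre, *Galois Cohomology* (1997), I §2.2–2.4. [SerreGaloisCohomology1997]
* J. S. Milne, *Arithmetic Duality Theorems* (2nd ed. 2006), I §0 (0.8), I Thm. 4.10 (proof, p. 58). [MilneADT2006]
* C. A. Weibel, *An introduction to homological algebra* (1994), §2.2 (projective modules, lifting). [Weibel1994]
-/

noncomputable section

namespace Literature.NumberTheory.GaloisRepresentations

open Function ContRepresentation

universe u

/-! ## §1 `δ₁` commutes with change of group; `δ₀` dies under a change of group that extends over `M₂` -/

namespace IsSES

variable {Γ Γ' : Type u} [Group Γ] [TopologicalSpace Γ] [IsTopologicalGroup Γ]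
  [Group Γ'] [TopologicalSpace Γ'] [IsTopologicalGroup Γ']
variable {M₁ M₂ M₃ M₁' M₂' M₃' : Type u}
  [AddCommGroup M₁] [TopologicalSpace M₁] [DiscreteTopology M₁]
  [AddCommGroup M₂] [TopologicalSpace M₂] [DiscreteTopology M₂]
  [AddCommGroup M₃] [TopologicalSpace M₃] [DiscreteTopology M₃]
  [AddCommGroup M₁'] [TopologicalSpace M₁'] [DiscreteTopology M₁']
  [AddCommGroup M₂'] [TopologicalSpace M₂'] [DiscreteTopology M₂']
  [AddCommGroup M₃'] [TopologicalSpace M₃'] [DiscreteTopology M₃']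
variable {ρ₁ : ContinuousRep Γ ℤ M₁} {ρ₂ : ContinuousRep Γ ℤ M₂} {ρ₃ : ContinuousRep Γ ℤ M₃}
variable {ρ₁' : ContinuousRep Γ' ℤ M₁'} {ρ₂' : ContinuousRep Γ' ℤ M₂'} {ρ₃' : ContinuousRep Γ' ℤ M₃'}
variable {f : ρ₁.toTopRep ⟶ ρ₂.toTopRep} {g : ρ₂.toTopRep ⟶ ρ₃.toTopRep}
variable {f' : ρ₁'.toTopRep ⟶ ρ₂'.toTopRep} {g' : ρ₂'.toTopRep ⟶ ρ₃'.toTopRep}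
variable (θ : Γ' →ₜ* Γ)
  (φ₁ : TopRep.res (θ : Γ' →* Γ) ρ₁.toTopRep ⟶ ρ₁'.toTopRep)
  (φ₂ : TopRep.res (θ : Γ' →* Γ) ρ₂.toTopRep ⟶ ρ₂'.toTopRep)
  (φ₃ : TopRep.res (θ : Γ' →* Γ) ρ₃.toTopRep ⟶ ρ₃'.toTopRep)

/-- **`δ₀` dies under a change of group whose coefficient map extends over `M₂`**: for `θ : Γ' → Γ`, a short exact
`0 → M₁ —f→ M₂ —g→ M₃ → 0` over `Γ`, a `Γ'`-module `M₁'` and `θ`-equivariant `φ₁ : M₁ → M₁'`, `φ₂' : M₂ → M₁'` with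
`φ₂' ∘ f = φ₁`, one has `H¹(θ, φ₁) (δ₀ v) = 0` for every invariant `v` of `M₃` (the pulled-back cocycle
`σ ↦ φ₁(f⁻¹((θσ) w − w)) = σ φ₂'(w) − φ₂'(w)` is principal). [cite: NeukirchSchmidtWingberg2008, (1.3.2), (1.5.2)]
[cite: SerreGaloisCohomology1997, I §2.2, §2.4] -/
theorem map_res_δ₀_eq_zero_of_extends (h : IsSES f g)
    (φ₂' : TopRep.res (θ : Γ' →* Γ) ρ₂.toTopRep ⟶ ρ₁'.toTopRep) (hext : ∀ x, φ₂'.hom (f.hom x) = φ₁.hom x)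
    (v : ρ₃.toTopRep.ρ.invariants) :
    ContinuousCohomology.map θ φ₁ 1 (h.δ₀ v) = 0 := by
  have hw : g.hom (h.lift v.1) = v := h.g_lift v.1
  rw [h.δ₀_apply_eq v (h.lift v.1) hw, map_oneCocycleClass, oneCocycleClass_eq_zero_iff]
  refine ⟨φ₂'.hom (h.lift v.1), fun σ => ?_⟩
  rw [contOneCocycles.pullback_apply, ← hext, h.f_δ₀Cocycle_apply, map_sub]
  congr 1
  exact TopRep.hom_comm_apply φ₂' σ _

variable [LocallyCompactSpace Γ] [LocallyCompactSpace Γ']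

/-- **`δ₁` commutes with change of group**: for `θ : Γ' → Γ`, short exact sequences `(f, g)` over `Γ` and `(f', g')` over
`Γ'` and `θ`-equivariant `φ₁, φ₂, φ₃` with `φ₂ f = f' φ₁`, `φ₃ g = g' φ₂`, one has `H²(θ, φ₁) (δ₁ x) = δ₁' (H¹(θ, φ₃) x)`
(the image `φ₂ ∘ φ̃ ∘ θ` of a continuous lift `φ̃` of a crossed homomorphism `ψ` lifts `φ₃ ∘ ψ ∘ θ`, and `φ₁` carries the
connecting cocycle of `φ̃`, pulled back along `θ`, to that of `φ₂ ∘ φ̃ ∘ θ`). [cite: NeukirchSchmidtWingberg2008, (1.3.3), (1.5.2)]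
[cite: SerreGaloisCohomology1997, I §2.3, §2.4] -/
theorem map_res_δ₁ (h : IsSES f g) (h' : IsSES f' g')
    (hsq₁ : ∀ x, φ₂.hom (f.hom x) = f'.hom (φ₁.hom x))
    (hsq₂ : ∀ y, φ₃.hom (g.hom y) = g'.hom (φ₂.hom y))
    (x : continuousCohomology 1 ρ₃.toTopRep) :
    ContinuousCohomology.map θ φ₁ 2 (h.δ₁ x) = h'.δ₁ (ContinuousCohomology.map θ φ₃ 1 x) := by
  obtain ⟨ψ, rfl⟩ := oneCocycleClass_surjective _ x
  -- the canonical lift `φ̃` of `ψ` and its image `φ₂ ∘ φ̃ ∘ θ`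
  let φt : C(Γ, M₂) := h.liftCocycle ψ
  let φt' : C(Γ', M₂') := (φ₂.hom : C(M₂, M₂')).comp (φt.comp (θ : C(Γ', Γ)))
  have hφt'v : ∀ σ, φt' σ = φ₂.hom (φt (θ σ)) := fun _ => rfl
  have hc₂ : ∀ (σ : Γ') (y : M₂), φ₂.hom (ρ₂ (θ σ) y) = ρ₂' σ (φ₂.hom y) := fun σ y =>
    TopRep.hom_comm_apply φ₂ σ y
  have hc₃ : ∀ (σ : Γ') (z : M₃), φ₃.hom (ρ₃ (θ σ) z) = ρ₃' σ (φ₃.hom z) := fun σ z =>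
    TopRep.hom_comm_apply φ₃ σ z
  have hφt' : ∀ σ τ, g'.hom (φt' (σ * τ)) = g'.hom (φt' σ) + ρ₃' σ (g'.hom (φt' τ)) := fun σ τ => by
    rw [hφt'v, hφt'v, hφt'v, ← hsq₂, ← hsq₂, ← hsq₂, map_mul θ, h.liftCocycle_isLift ψ, map_add, hc₃]
  -- `H¹(θ, φ₃) [ψ] = [g' ∘ (φ₂ ∘ φ̃ ∘ θ)]`
  have e1 : ContinuousCohomology.map θ φ₃ 1 (oneCocycleClass _ ψ) = oneCocycleClass _ (pushCocycle φt' hφt') := by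
    rw [map_oneCocycleClass]
    refine congrArg _ (Subtype.ext (ContinuousMap.ext fun σ => ?_))
    rw [contOneCocycles.pullback_apply, pushCocycle_apply, hφt'v, ← hsq₂]
    exact congrArg φ₃.hom (h.g_liftCocycle_apply ψ (θ σ)).symm
  have e0 : oneCocycleClass _ ψ = oneCocycleClass _ (pushCocycle φt (h.liftCocycle_isLift ψ)) := by
    rw [h.pushCocycle_liftCocycle ψ]
  rw [e1, h'.δ₁_oneCocycleClass φt' hφt', e0, h.δ₁_oneCocycleClass φt (h.liftCocycle_isLift ψ),
    map_twoCocycleClass]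
  refine congrArg _ (Subtype.ext (ContinuousMap.ext fun p => ?_))
  obtain ⟨σ, τ⟩ := p
  rw [contTwoCocycles.pullback_apply]
  apply h'.injective
  rw [h'.f_connectingCocycle_apply, ← hsq₁, h.f_connectingCocycle_apply, map_add, map_sub, hc₂, hφt'v, hφt'v,
    hφt'v, map_mul θ]

end IsSES

/-! ## §2 Post-composition `Hom_ℤ(N, Y) → Hom_ℤ(N, Z)` along an equivariant `u : Y → Z` -/

namespace HomDual

open Literature.Algebra.Homology Literature.Algebra.Homology.DiscreteRep Field DiscreteGaloisModule

variable {K : Type} [Field K]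
variable {N X Y Z : Type}
  [AddCommGroup N] [TopologicalSpace N] [DiscreteTopology N] [Module.Finite ℤ N]
  [AddCommGroup X] [TopologicalSpace X] [DiscreteTopology X]
  [AddCommGroup Y] [TopologicalSpace Y] [DiscreteTopology Y]
  [AddCommGroup Z] [TopologicalSpace Z] [DiscreteTopology Z]
variable (ρN : DiscreteGaloisModule K N) (ρX : DiscreteGaloisModule K X) (ρY : DiscreteGaloisModule K Y)
  (ρZ : DiscreteGaloisModule K Z)

/-- The underlying additive map `F ↦ u ∘ F` on the `Hom`-carriers. [cite: MilneADT2006, I §0 (0.8)] -/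
def postcompCarrier (u : Y →ₗ[ℤ] Z) : DiscreteRep.HomCarrier N Y →+ DiscreteRep.HomCarrier N Z where
  toFun F := u ∘ₗ (show N →ₗ[ℤ] Y from F)
  map_zero' := LinearMap.ext fun _ => map_zero u
  map_add' _ _ := LinearMap.ext fun _ => map_add u _ _

omit [TopologicalSpace N] [DiscreteTopology N] [Module.Finite ℤ N] [TopologicalSpace Y] [DiscreteTopology Y]
  [TopologicalSpace Z] [DiscreteTopology Z] in
/-- Unfolding. [cite: MilneADT2006, I §0 (0.8)] -/
@[simp] theorem postcompCarrier_apply_apply (u : Y →ₗ[ℤ] Z) (F : DiscreteRep.HomCarrier N Y) (x : N) :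
    (show N →ₗ[ℤ] Z from postcompCarrier (N := N) u F) x = u ((show N →ₗ[ℤ] Y from F) x) := rfl

/-- **`u_* : Hom_ℤ(N, Y) → Hom_ℤ(N, Z)`, `F ↦ u ∘ F`, as a continuous equivariant map of discrete Galois modules** for an
equivariant `u : Y → Z` (`u ∘ (σ F σ⁻¹) = σ (u ∘ F) σ⁻¹`). [cite: MilneADT2006, I §0 (0.8)] -/
def postcomp (u : ρY.toContRepresentation →ⁱL ρZ.toContRepresentation) :
    (homGaloisModule ρN ρY).toContRepresentation →ⁱL (homGaloisModule ρN ρZ).toContRepresentation where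
  toLinearMap := (postcompCarrier (N := N) u.toContinuousLinearMap.toLinearMap).toIntLinearMap
  cont := continuous_of_discreteTopology
  isIntertwining' σ := by
    refine ContinuousLinearMap.ext fun F => ?_
    refine LinearMap.ext fun x => ?_
    change u ((show N →ₗ[ℤ] Y from homGaloisModule ρN ρY σ F) x) =
      (show N →ₗ[ℤ] Z from homGaloisModule ρN ρZ σ (postcompCarrier (N := N) u.toLinearMap F)) x
    rw [homGaloisModule_apply, homGaloisModule_apply]
    change u.toContinuousLinearMap (ρY σ ((show N →ₗ[ℤ] Y from F) (ρN σ⁻¹ x))) =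
      ρZ σ (u.toContinuousLinearMap ((show N →ₗ[ℤ] Y from F) (ρN σ⁻¹ x)))
    simpa [ContinuousRep.toContRepresentation_apply_apply] using
      congr($(u.isIntertwining' σ) ((show N →ₗ[ℤ] Y from F) (ρN σ⁻¹ x)))

/-- Unfolding: `postcomp u F = u ∘ F`. [cite: MilneADT2006, I §0 (0.8)] -/
@[simp] theorem postcomp_apply_apply (u : ρY.toContRepresentation →ⁱL ρZ.toContRepresentation)
    (F : DiscreteRep.HomCarrier N Y) (x : N) :
    (show N →ₗ[ℤ] Z from postcomp ρN ρY ρZ u F) x = u ((show N →ₗ[ℤ] Y from F) x) := rfl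

/-- `postcomp` commutes with `precomp`: `u ∘ (F ∘ w) = (u ∘ F) ∘ w`. [cite: MilneADT2006, I §0 (0.8)] -/
theorem postcomp_precomp {N' : Type} [AddCommGroup N'] [TopologicalSpace N'] [DiscreteTopology N'] [Module.Finite ℤ N']
    (ρN' : DiscreteGaloisModule K N') (w : ρN.toContRepresentation →ⁱL ρN'.toContRepresentation)
    (u : ρY.toContRepresentation →ⁱL ρZ.toContRepresentation) (F : DiscreteRep.HomCarrier N' Y) :
    postcomp ρN ρY ρZ u (precomp ρN ρN' ρY w F) = precomp ρN ρN' ρZ w (postcomp ρN' ρY ρZ u F) := rfl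

/-! ## §3 `0 → Hom_ℤ(N, X) → Hom_ℤ(N, Y) → Hom_ℤ(N, Z) → 0` is short exact for a lattice `N` -/

section Hom

variable (i : ρX.toContRepresentation →ⁱL ρY.toContRepresentation)
  (p : ρY.toContRepresentation →ⁱL ρZ.toContRepresentation)

/-- `i_* : Hom(N, X) ⟶ Hom(N, Y)` in `TopRep`. [cite: MilneADT2006, I §0 (0.8)] -/
abbrev homF : (homGaloisModule ρN ρX).toTopRep ⟶ (homGaloisModule ρN ρY).toTopRep :=
  toTopRepHom (homGaloisModule ρN ρX) (homGaloisModule ρN ρY) (postcomp ρN ρX ρY i)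

/-- `p_* : Hom(N, Y) ⟶ Hom(N, Z)` in `TopRep`. [cite: MilneADT2006, I §0 (0.8)] -/
abbrev homG : (homGaloisModule ρN ρY).toTopRep ⟶ (homGaloisModule ρN ρZ).toTopRep :=
  toTopRepHom (homGaloisModule ρN ρY) (homGaloisModule ρN ρZ) (postcomp ρN ρY ρZ p)

/-- **The covariant `Hom(N, ·)`-image of a short exact sequence of discrete modules is short exact for `N` projective
over `ℤ`**: `0 → Hom_ℤ(N, X) → Hom_ℤ(N, Y) → Hom_ℤ(N, Z) → 0` (exactness on the right is the lifting property of `N`).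
[cite: Weibel1994, §2.2][cite: MilneADT2006, I §0 (0.8)] -/
theorem isSES_hom [Module.Projective ℤ N] (hS : IsSES (toTopRepHom ρX ρY i) (toTopRepHom ρY ρZ p)) :
    IsSES (homF ρN ρX ρY i) (homG ρN ρY ρZ p) where
  comp_eq_zero := by
    apply TopRep.hom_ext
    rw [TopRep.hom_comp, TopRep.hom_zero]
    refine DFunLike.ext _ _ fun F => ?_
    change (show N →ₗ[ℤ] Z from postcomp ρN ρY ρZ p (postcomp ρN ρX ρY i F)) = (0 : N →ₗ[ℤ] Z)
    refine LinearMap.ext fun x => ?_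
    change p (i ((show N →ₗ[ℤ] X from F) x)) = 0
    exact hS.g_f_apply _
  injective := by
    intro F F' h
    have h' : (show N →ₗ[ℤ] Y from postcomp ρN ρX ρY i F) = (show N →ₗ[ℤ] Y from postcomp ρN ρX ρY i F') := h
    change (show N →ₗ[ℤ] X from F) = (show N →ₗ[ℤ] X from F')
    refine LinearMap.ext fun x => hS.injective ?_
    exact LinearMap.congr_fun h' x
  exact_mid := by
    intro G hG
    have hG' : (show N →ₗ[ℤ] Z from postcomp ρN ρY ρZ p G) = (0 : N →ₗ[ℤ] Z) := hG
    have hker : ∀ x, p ((show N →ₗ[ℤ] Y from G) x) = 0 := fun x => LinearMap.congr_fun hG' x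
    -- `G` takes values in `ker p = im i`; `i⁻¹ ∘ G` is additive because `i` is injective
    let F : N →+ X := AddMonoidHom.mk' (fun x => hS.inv ((show N →ₗ[ℤ] Y from G) x)) fun x y =>
      hS.injective (by
        rw [hS.f_inv (hker _), map_add (show N →ₗ[ℤ] Y from G), map_add, hS.f_inv (hker _), hS.f_inv (hker _)])
    refine ⟨(F.toIntLinearMap : DiscreteRep.HomCarrier N X), ?_⟩
    change (show N →ₗ[ℤ] Y from postcomp ρN ρX ρY i (F.toIntLinearMap : DiscreteRep.HomCarrier N X)) =
      (show N →ₗ[ℤ] Y from G)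
    refine LinearMap.ext fun x => ?_
    exact hS.f_inv (hker x)
  surjective := by
    intro H
    obtain ⟨F, hF⟩ := Module.projective_lifting_property p.toContinuousLinearMap.toLinearMap
      (show N →ₗ[ℤ] Z from H) hS.surjective
    exact ⟨(F : DiscreteRep.HomCarrier N Y), LinearMap.ext fun x => LinearMap.congr_fun hF x⟩

end Hom

end HomDual

end Literature.NumberTheory.GaloisRepresentations

end
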